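import Literature.AlgebraicGeometry.Morphisms.ProperPushforwardCoh
import HarnessLib

/-!
# Route `HomologicalConductor`, support `SurfaceTermination` (stmt-ResolutionOfSingularities-16488):
# the «good» cover of the middle space for the (S)-step of `stub_pgNonincreasing`

`[OURS · L W4.4]` Cell res-hironaka, crux chain W4.4, kill test K4.4-s; brick «GW-GLUE» of
res-L0-w44-stub-4 (the cover input of `Literature/AlgebraicGeometry/Morphisms/CechH1PreimageGluing.lean`,
`cechRefineH1_preimage_piece_surjective_of_GW`).  Nothing here is a statement of the manuscript under
review (Hironaka 2017); AI-written, weaker than expert review.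

* `exists_affineCover_eq_and_disjoint` — on a Noetherian scheme `B`, an affine open `W₀` and a finite
  set `S ⊆ W₀` of closed points of `B` admit a finite affine open cover `W : α → B.Opens` of `B` with a
  distinguished index `a₀`, `W a₀ = W₀`, and every other member disjoint from `S`.

In the (S)-step (res-D-pv-045's PG-LERAY-NOTE §1): `B = Bl_{ca(T)}(Spec T)`, `W₀ = D₊(x)`, `S` = the
images of the finitely many singular points of the normalised chart `Spec N`; then the mixed overlaps
`W₀ ∩ W_b` (`b ≠ a₀`) contain no bad point, their preimages have `Ȟ¹ = 0`, and
`cechRefineH1_preimage_piece_surjective_of_GW` applies.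

No named facts; no definitions.
-/

-- single-problem summit: the doubled namespace component `ResolutionOfSingularities` is forced
set_option linter.dupNamespace false

noncomputable section

open CategoryTheory AlgebraicGeometry TopologicalSpace
open Literature.AlgebraicGeometry.Morphisms

universe u

namespace Summit.ResolutionOfSingularities.ResolutionOfSingularities.Theorems.SurfaceTermination.GenusDescent

variable {B : Scheme.{u}} [NoetherianSpace B]

/-- **The «good» cover.** On a Noetherian scheme `B`, given an affine open `W₀` and a finite set `S`
of closed points of `B` contained in `W₀`, there is a finite affine open cover `W : α → B.Opens` of
`B` with a distinguished index `a₀`, `W a₀ = W₀`, and every OTHER member disjoint from `S` (cover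
the open `B ∖ S` by finitely many affine opens inside it and add `W₀`).  In the (S)-step: `W₀ = D₊(x)`
and `S` = the images of the finitely many singular points of the normalised chart, so that the
mixed overlaps `W₀ ∩ W_b` contain no bad point.  OURS. [this work] -/
theorem exists_affineCover_eq_and_disjoint (W₀ : B.Opens) (hW₀ : IsAffineOpen W₀) (S : Set B)
    (hS : S.Finite) (hSc : ∀ p ∈ S, IsClosed ({p} : Set B)) (hSW : S ⊆ (W₀ : Set B)) :
    ∃ (α : Type u) (_ : Finite α) (a₀ : α) (W : α → B.Opens), W a₀ = W₀ ∧
      (∀ a, IsAffineOpen (W a)) ∧ ⨆ a, W a = ⊤ ∧ ∀ a, a ≠ a₀ → Disjoint S (W a : Set B) := by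
  classical
  -- the open complement of `S`
  have hSclosed : IsClosed S := by
    have : S = ⋃ p ∈ S, ({p} : Set B) := by
      ext x; simp
    rw [this]
    exact hS.isClosed_biUnion fun p hp => hSc p hp
  let O : B.Opens := ⟨Sᶜ, hSclosed.isOpen_compl⟩
  obtain ⟨t, ht⟩ := exists_finset_affine_cover O (NoetherianSpace.isCompact _)
  refine ⟨Option t, inferInstance, none,
    fun a => a.elim W₀ fun V : t =>
      (((V : {V : B.affineOpens // (V : B.Opens) ≤ O}) : B.affineOpens) : B.Opens),
    rfl, ?_, ?_, ?_⟩
  · rintro (_ | V)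
    · exact hW₀
    · exact ((V : {V : B.affineOpens // (V : B.Opens) ≤ O}) : B.affineOpens).2
  · -- the union is everything: a point of `S` lies in `W₀`, a point off `S` lies in `O = ⋃ t`
    refine le_antisymm le_top fun x _ => ?_
    by_cases hx : x ∈ S
    · exact Opens.mem_iSup.mpr ⟨none, hSW hx⟩
    · have hxO : x ∈ ⨆ V : t,
          (((V : {V : B.affineOpens // (V : B.Opens) ≤ O}) : B.affineOpens) : B.Opens) := by
        rw [ht]
        exact hx
      obtain ⟨V, hV⟩ := Opens.mem_iSup.mp hxO
      exact Opens.mem_iSup.mpr ⟨some V, hV⟩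
  · rintro (_ | V) h
    · exact absurd rfl h
    · refine Set.disjoint_left.mpr fun p hpS hpV => ?_
      have hle : (((V : {V : B.affineOpens // (V : B.Opens) ≤ O}) : B.affineOpens) : B.Opens) ≤ O :=
        (V : {V : B.affineOpens // (V : B.Opens) ≤ O}).2
      exact (hle hpV) hpS

end Summit.ResolutionOfSingularities.ResolutionOfSingularities.Theorems.SurfaceTermination.GenusDescent

end
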